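import Literature.Analysis.Complex.HolomorphicParametricIntegral
import Literature.Analysis.Complex.OsgoodProofs
import Mathlib
import HarnessLib

/-!
# LINE g20-A «angular type» (crux ⟨stmt-QuantumFields-23035⟩ `ShortRootRigidity`) — rung R-S3a `FlatDoubleEdgeModel` BY NAME

Owner file `Cruxes/ShortRootRigidity/Lines/angular_type_rungs.lean` v3 (planner ym-idea-3 g21, sha16 a8a830bd1d79bc63): the LOCAL BOCHNER TUBE
THEOREM for the flat «L-shaped» configuration `{Im w₁ > 0} ∪ {Im w₂ > 0} ⊂ ℂ²` WITH THE SUP BOUND, at unit scale (sup norm on `ℂ × ℂ`).  The Prop is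
restated CHARACTER-IDENTICALLY and `flatDoubleEdgeModel_holds : FlatDoubleEdgeModel` is proved by the owner's explicit disc family

  `φ_q(λ) = q + (λ, −λ + i c λ²)`,  `c = 1/2`, circle radius `r = 1/4` (`c r = 1/8`).

PROOF.  For `q` in the convex parameter region `Q = {‖q‖ < 1/2, Im q₁ > −η, |Im q₂| < η}` (`η = 1/256`) every point of the circle `φ_q(∂D_r)`
lies in the domain `U = {‖w‖ < 1} ∩ ({Im w₁ > 0} ∪ {Im w₂ > 0})`: with `s = sin θ`, `Im φ₁ = Im q₁ + rs > 0` when `s > η/r`, and otherwise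
`Im φ₂ = Im q₂ − rs + cr²(1 − 2s²) > 0` (`discMap_circle_mem`, `nlinarith`).  Hence the circle average `G(q) = (2π)⁻¹∫ f(φ_q(re^{iθ})) dθ` is
holomorphic on `Q` (holomorphic parameter integral with the constant majorant `M`: tree lemma
`Literature.Analysis.Complex.differentiableOn_integral_of_dominated`), bounded by `M`, and equal to `f(q)` wherever the CLOSED disc lies in
`{Im w₁ > 0}` (Cauchy's mean value formula), e.g. near `q⋆ = (0.3i, 0) ∈ Q`.  Since `Q ∩ U = (Q ∩ {Im q₁ > 0}) ∪ (Q ∩ {Im q₂ > 0})` is a union of two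
convex sets with a common point, it is preconnected, and the identity theorem (`AnalyticOnNhd.eqOn_of_preconnected_of_eventuallyEq`, analyticity
from `Literature.Analysis.Complex.SCV.analyticOnNhd_of_differentiableOn`) gives `G = f` on `Q ∩ U ⊇ ball 0 η ∩ U`.  So `δ = η = 1/256`.

HONEST LABEL: one rung (the local SCV step) of the OPEN stub (C) `stub_planarSpectralCone`; R-S3b/R-S3d, (C), ⟨23035⟩, ⟨23125⟩ (`DiagonalGain`),
R2d and the Yang–Mills mass gap remain OPEN; no summit is proved by a line.  Lead seat `ym-line-sfw-p2` g75 (cell ym-idea-1, free hands).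
-/

set_option autoImplicit false

noncomputable section

open MeasureTheory Filter Topology Set Metric Complex Real
open scoped BigOperators Real

namespace Summit.QuantumFields.YangMills.Theorems.F4SubCurvatureDoorFlatDoubleEdgeModelRegistered

/-! ## The rung (character-identical with `Lines/angular_type_rungs.lean` v3) -/

/-- **R-S3a · FlatDoubleEdgeModel** (target, M, Mathlib-only; the local Bochner tube theorem for the L-shaped base WITH the sup bound, unit
scale at the origin of `ℂ × ℂ` (sup norm)): a bounded holomorphic function on `{‖w‖ < 1} ∩ ({Im w₁ > 0} ∪ {Im w₂ > 0})` extends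
holomorphically, with the same bound, to the ball of radius `δ` (a constant of geometry, independent of `f`).  Proof: the disc family
`φ_q(λ) = q + (λ, −λ + icλ²)` of the section docstring.  [Komatsu 1972 (local tube theorem); Kato–Struppa 2020 Thm 1.4.1; here elementary] -/
def FlatDoubleEdgeModel : Prop :=
  ∃ δ : ℝ, 0 < δ ∧ ∀ (f : ℂ × ℂ → ℂ) (M : ℝ),
    DifferentiableOn ℂ f {w : ℂ × ℂ | ‖w‖ < 1 ∧ (0 < w.1.im ∨ 0 < w.2.im)} →
    (∀ w : ℂ × ℂ, ‖w‖ < 1 → (0 < w.1.im ∨ 0 < w.2.im) → ‖f w‖ ≤ M) →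
    ∃ g : ℂ × ℂ → ℂ, DifferentiableOn ℂ g (Metric.ball 0 δ) ∧ (∀ w ∈ Metric.ball (0 : ℂ × ℂ) δ, ‖g w‖ ≤ M) ∧
      ∀ w ∈ Metric.ball (0 : ℂ × ℂ) δ, (0 < w.1.im ∨ 0 < w.2.im) → g w = f w

/-! ## The disc family and its geometry -/

/-- The domain: the unit sup-ball minus the closed «third quadrant» of imaginary parts. -/
def Udom : Set (ℂ × ℂ) := {w : ℂ × ℂ | ‖w‖ < 1 ∧ (0 < w.1.im ∨ 0 < w.2.im)}

/-- The owner's analytic discs `φ_q(λ) = q + (λ, −λ + (i/2)λ²)`. -/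
def discMap (q : ℂ × ℂ) (l : ℂ) : ℂ × ℂ := (q.1 + l, q.2 - l + I * (1 / 2 : ℂ) * l ^ 2)

/-- The disc through `q` is centred at `q`. -/
theorem discMap_zero (q : ℂ × ℂ) : discMap q 0 = q := by
  simp [discMap]

/-- Translation structure of the family. -/
theorem discMap_eq_add (q : ℂ × ℂ) (l : ℂ) : discMap q l = q + discMap 0 l := by
  ext
  · simp [discMap]
  · simp [discMap]; ring

/-- `q ↦ φ_q(λ)` is affine, hence holomorphic. -/
theorem differentiable_discMap_left (l : ℂ) : Differentiable ℂ fun q : ℂ × ℂ => discMap q l := by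
  have : (fun q : ℂ × ℂ => discMap q l) = fun q => q + discMap 0 l := by
    funext q; exact discMap_eq_add q l
  rw [this]
  exact differentiable_id.add (differentiable_const _)

/-- `λ ↦ φ_q(λ)` is polynomial, hence holomorphic. -/
theorem differentiable_discMap_right (q : ℂ × ℂ) : Differentiable ℂ fun l : ℂ => discMap q l := by
  unfold discMap
  fun_prop

/-- Sup-norm control: `‖φ_q(λ)‖ < 1` for `‖q‖ < 1/2`, `|λ| ≤ 1/4`. -/
theorem norm_discMap_lt_one {q : ℂ × ℂ} {l : ℂ} (hq : ‖q‖ < 1 / 2) (hl : ‖l‖ ≤ 1 / 4) : ‖discMap q l‖ < 1 := by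
  have hq1 : ‖q.1‖ < 1 / 2 := lt_of_le_of_lt (norm_fst_le q) hq
  have hq2 : ‖q.2‖ < 1 / 2 := lt_of_le_of_lt (norm_snd_le q) hq
  have h1 : ‖q.1 + l‖ < 1 := by
    refine lt_of_le_of_lt (norm_add_le _ _) ?_; linarith
  have hl2 : ‖I * (1 / 2 : ℂ) * l ^ 2‖ ≤ 1 / 32 := by
    rw [norm_mul, norm_mul, Complex.norm_I, one_mul, norm_pow]
    have : ‖l‖ ^ 2 ≤ (1 / 4) ^ 2 := pow_le_pow_left₀ (norm_nonneg _) hl 2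
    have h12 : ‖(1 / 2 : ℂ)‖ = 1 / 2 := by simp
    rw [h12]; nlinarith
  have h2 : ‖q.2 - l + I * (1 / 2 : ℂ) * l ^ 2‖ < 1 := by
    refine lt_of_le_of_lt (norm_add_le _ _) ?_
    have := norm_sub_le q.2 l
    linarith
  rw [discMap, Prod.norm_def]
  exact max_lt h1 h2

/-- Real and imaginary parts of the circle point `r e^{iθ}`. -/
theorem circleMap_zero_re_im (R θ : ℝ) : (circleMap 0 R θ).re = R * Real.cos θ ∧ (circleMap 0 R θ).im = R * Real.sin θ := by
  constructor <;> simp [circleMap, Complex.exp_mul_I, Complex.cos_ofReal_re, Complex.sin_ofReal_re]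

/-- First imaginary part along the circle: `Im q₁ + r sin θ`. -/
theorem im_fst_discMap_circle (q : ℂ × ℂ) (R θ : ℝ) : (discMap q (circleMap 0 R θ)).1.im = q.1.im + R * Real.sin θ := by
  simp [discMap, (circleMap_zero_re_im R θ).2]

/-- Second imaginary part along the circle of radius `1/4`: `Im q₂ − sin θ/4 + (1 − 2 sin²θ)/32`. -/
theorem im_snd_discMap_circle (q : ℂ × ℂ) (θ : ℝ) :
    (discMap q (circleMap 0 (1 / 4) θ)).2.im = q.2.im - 1 / 4 * Real.sin θ + 1 / 32 * (1 - 2 * Real.sin θ ^ 2) := by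
  obtain ⟨hre, him⟩ := circleMap_zero_re_im (1 / 4) θ
  have hcos : Real.cos θ ^ 2 = 1 - Real.sin θ ^ 2 := by rw [← Real.sin_sq_add_cos_sq θ]; ring
  simp only [discMap, Complex.add_im, Complex.sub_im, Complex.mul_im, Complex.mul_re, Complex.I_re, Complex.I_im, sq, hre, him,
    zero_mul, one_mul, zero_sub, zero_add]
  norm_num
  nlinarith [hcos]

/-- The parameter region (convex, open): `‖q‖ < 1/2`, `Im q₁ > −1/256`, `|Im q₂| < 1/256`. -/
def Qreg : Set (ℂ × ℂ) := {q : ℂ × ℂ | ‖q‖ < 1 / 2 ∧ -(1 / 256 : ℝ) < q.1.im ∧ |q.2.im| < 1 / 256}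

/-- KEY GEOMETRY: for `q ∈ Q` the whole circle `φ_q(∂D_{1/4})` lies in the domain `U`. -/
theorem discMap_circle_mem {q : ℂ × ℂ} (hq : q ∈ Qreg) (θ : ℝ) : discMap q (circleMap 0 (1 / 4) θ) ∈ Udom := by
  obtain ⟨hqn, hq1, hq2⟩ := hq
  refine ⟨norm_discMap_lt_one hqn (by simp [norm_circleMap_zero]), ?_⟩
  rw [im_fst_discMap_circle, im_snd_discMap_circle]
  rw [abs_lt] at hq2
  set s := Real.sin θ with hs
  have hs1 : -1 ≤ s := Real.neg_one_le_sin θ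
  have hs2 : s ≤ 1 := Real.sin_le_one θ
  by_cases h : 1 / 64 < s
  · left; nlinarith
  · right
    rw [not_lt] at h
    nlinarith [mul_nonneg (sub_nonneg.2 h) (sub_nonneg.2 (show (-1:ℝ) ≤ s from hs1))]

/-! ## Openness and convexity -/

/-- `w ↦ Im w₁` is `ℝ`-linear on `ℂ × ℂ`. -/
theorem isLinearMap_im_fst : IsLinearMap ℝ fun w : ℂ × ℂ => w.1.im :=
  ⟨fun x y => by simp, fun c x => by simp⟩

/-- `w ↦ Im w₂` is `ℝ`-linear on `ℂ × ℂ`. -/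
theorem isLinearMap_im_snd : IsLinearMap ℝ fun w : ℂ × ℂ => w.2.im :=
  ⟨fun x y => by simp, fun c x => by simp⟩

/-- The domain `U` is open. -/
theorem isOpen_Udom : IsOpen Udom := by
  refine (isOpen_lt continuous_norm continuous_const).inter (IsOpen.union ?_ ?_)
  · exact isOpen_lt continuous_const (Complex.continuous_im.comp continuous_fst)
  · exact isOpen_lt continuous_const (Complex.continuous_im.comp continuous_snd)

/-- The parameter region `Q` is open. -/
theorem isOpen_Qreg : IsOpen Qreg := by
  have hQ : Qreg = {q : ℂ × ℂ | ‖q‖ < 1 / 2} ∩ ({q : ℂ × ℂ | -(1 / 256 : ℝ) < q.1.im} ∩ {q : ℂ × ℂ | |q.2.im| < 1 / 256}) := by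
    ext q; simp [Qreg]
  rw [hQ]
  refine (isOpen_lt continuous_norm continuous_const).inter ((isOpen_lt continuous_const ?_).inter (isOpen_lt ?_ continuous_const))
  · exact Complex.continuous_im.comp continuous_fst
  · exact continuous_abs.comp (Complex.continuous_im.comp continuous_snd)

/-- The parameter region `Q` is convex. -/
theorem convex_Qreg : Convex ℝ Qreg := by
  have h1 : Convex ℝ {q : ℂ × ℂ | ‖q‖ < 1 / 2} := by
    have : {q : ℂ × ℂ | ‖q‖ < 1 / 2} = Metric.ball 0 (1 / 2) := by ext q; simp
    rw [this]; exact convex_ball _ _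
  have h2 : Convex ℝ {q : ℂ × ℂ | -(1 / 256 : ℝ) < q.1.im} := convex_halfSpace_gt isLinearMap_im_fst _
  have h3 : Convex ℝ {q : ℂ × ℂ | |q.2.im| < 1 / 256} := by
    have : {q : ℂ × ℂ | |q.2.im| < 1 / 256} = {q : ℂ × ℂ | q.2.im < 1 / 256} ∩ {q : ℂ × ℂ | -(1 / 256 : ℝ) < q.2.im} := by
      ext q; simp only [mem_setOf_eq, mem_inter_iff, abs_lt]; tauto
    rw [this]
    exact (convex_halfSpace_lt isLinearMap_im_snd _).inter (convex_halfSpace_gt isLinearMap_im_snd _)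
  have hQ : Qreg = {q : ℂ × ℂ | ‖q‖ < 1 / 2} ∩ ({q : ℂ × ℂ | -(1 / 256 : ℝ) < q.1.im} ∩ {q : ℂ × ℂ | |q.2.im| < 1 / 256}) := by
    ext q; simp [Qreg]
  rw [hQ]
  exact h1.inter (h2.inter h3)

/-- A small ball lies in `Q`. -/
theorem ball_subset_Qreg : Metric.ball (0 : ℂ × ℂ) (1 / 256) ⊆ Qreg := by
  intro q hq
  rw [mem_ball_zero_iff] at hq
  have h1 : |q.1.im| ≤ ‖q‖ := (Complex.abs_im_le_norm _).trans (norm_fst_le q)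
  have h2 : |q.2.im| ≤ ‖q‖ := (Complex.abs_im_le_norm _).trans (norm_snd_le q)
  rw [abs_le] at h1
  exact ⟨by linarith, by linarith, lt_of_le_of_lt h2 hq⟩

/-! ## The circle average: holomorphic in the parameter, bounded, and equal to `f` where the closed disc fits -/

/-- The extension: the average of `f` over the circle `φ_q(∂D_{1/4})`. -/
def ext (f : ℂ × ℂ → ℂ) (q : ℂ × ℂ) : ℂ := circleAverage (fun l => f (discMap q l)) 0 (1 / 4)

/-- The circle average as a Lebesgue integral over `(0, 2π]`. -/
theorem ext_eq_integral (f : ℂ × ℂ → ℂ) (q : ℂ × ℂ) :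
    ext f q = (2 * π)⁻¹ • ∫ θ in Set.Ioc 0 (2 * π), f (discMap q (circleMap 0 (1 / 4) θ)) := by
  rw [ext, circleAverage_def, intervalIntegral.integral_of_le (by positivity)]

/-- HOLOMORPHY: the circle average is holomorphic on `Q` (holomorphic parameter integral with the constant majorant `M`). -/
theorem differentiableOn_ext {f : ℂ × ℂ → ℂ} {M : ℝ} (hf : DifferentiableOn ℂ f Udom) (hM : ∀ w ∈ Udom, ‖f w‖ ≤ M) :
    DifferentiableOn ℂ (ext f) Qreg := by
  have hF : DifferentiableOn ℂ (fun q : ℂ × ℂ => ∫ θ in Set.Ioc 0 (2 * π), f (discMap q (circleMap 0 (1 / 4) θ))) Qreg := by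
    refine Literature.Analysis.Complex.differentiableOn_integral_of_dominated
      (μ := volume.restrict (Set.Ioc 0 (2 * π))) (F := fun (q : ℂ × ℂ) (θ : ℝ) => f (discMap q (circleMap 0 (1 / 4) θ)))
      (U := Qreg) ?_ ?_ ?_
    · intro q hq
      have h1 : Continuous fun θ : ℝ => discMap q (circleMap 0 (1 / 4) θ) :=
        (differentiable_discMap_right q).continuous.comp (continuous_circleMap 0 (1 / 4))
      exact (hf.continuousOn.comp_continuous h1 fun θ => discMap_circle_mem hq θ).aestronglyMeasurable
    · exact ae_of_all _ fun θ => hf.comp (differentiable_discMap_left _).differentiableOn fun q hq => discMap_circle_mem hq θ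
    · intro q₀ hq₀
      obtain ⟨R, hR, hRQ⟩ := Metric.isOpen_iff.1 isOpen_Qreg q₀ hq₀
      exact ⟨R, hR, hRQ, fun _ => M, integrable_const M, ae_of_all _ fun θ q hq => hM _ (discMap_circle_mem (hRQ hq) θ)⟩
  have heq : ext f = fun q => (2 * π)⁻¹ • ∫ θ in Set.Ioc 0 (2 * π), f (discMap q (circleMap 0 (1 / 4) θ)) := by
    funext q; exact ext_eq_integral f q
  rw [heq]
  exact hF.const_smul ((2 * π)⁻¹ : ℝ)

/-- BOUND: the circle average is bounded by the bound of `f`. -/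
theorem norm_ext_le {f : ℂ × ℂ → ℂ} {M : ℝ} (hM : ∀ w ∈ Udom, ‖f w‖ ≤ M) {q : ℂ × ℂ} (hq : q ∈ Qreg) : ‖ext f q‖ ≤ M := by
  have h := intervalIntegral.norm_integral_le_of_norm_le_const (a := 0) (b := 2 * π) (C := M)
    (f := fun θ => f (discMap q (circleMap 0 (1 / 4) θ))) (fun θ _ => hM _ (discMap_circle_mem hq θ))
  rw [sub_zero, abs_of_pos (by positivity)] at h
  rw [ext, circleAverage_def, norm_smul, Real.norm_eq_abs, abs_inv, abs_of_pos (by positivity : (0 : ℝ) < 2 * π)]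
  calc (2 * π)⁻¹ * ‖∫ θ in (0 : ℝ)..2 * π, f (discMap q (circleMap 0 (1 / 4) θ))‖ ≤ (2 * π)⁻¹ * (M * (2 * π)) := by gcongr
    _ = M := by field_simp

/-- MEAN VALUE: where the CLOSED disc lies in the domain, the circle average is `f(q)` (Cauchy's formula at the centre). -/
theorem ext_eq_self {f : ℂ × ℂ → ℂ} (hf : DifferentiableOn ℂ f Udom) {q : ℂ × ℂ}
    (hdisc : ∀ l : ℂ, ‖l‖ ≤ 1 / 4 → discMap q l ∈ Udom) : ext f q = f q := by
  have hdiff : ∀ l : ℂ, ‖l‖ ≤ 1 / 4 → DifferentiableAt ℂ (fun l => f (discMap q l)) l := fun l hl =>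
    (hf.differentiableAt (isOpen_Udom.mem_nhds (hdisc l hl))).comp l (differentiable_discMap_right q l)
  rw [ext, circleAverage_eq_circleIntegral (by norm_num : (1 / 4 : ℝ) ≠ 0)]
  have h := Complex.two_pi_I_inv_smul_circleIntegral_sub_inv_smul_of_differentiable_on_off_countable
    (f := fun l => f (discMap q l)) (c := 0) (R := 1 / 4) (w := 0) (s := ∅) countable_empty (mem_ball_self (by norm_num))
    (fun l hl => (hdiff l (mem_closedBall_zero_iff.1 hl)).continuousAt.continuousWithinAt)
    (fun l hl => hdiff l (le_of_lt (mem_ball_zero_iff.1 hl.1)))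
  simp only [sub_zero] at h ⊢
  rw [h, discMap_zero]

/-! ## Identity theorem on `Q ∩ U` -/

/-- `Q ∩ U` is preconnected: two convex pieces with a common point. -/
theorem isPreconnected_Qreg_inter :
    IsPreconnected (Qreg ∩ {w : ℂ × ℂ | 0 < w.1.im ∨ 0 < w.2.im}) := by
  have hW : Qreg ∩ {w : ℂ × ℂ | 0 < w.1.im ∨ 0 < w.2.im} =
      (Qreg ∩ {w : ℂ × ℂ | 0 < w.1.im}) ∪ (Qreg ∩ {w : ℂ × ℂ | 0 < w.2.im}) := by
    ext w; simp only [mem_inter_iff, mem_setOf_eq, mem_union]; tauto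
  rw [hW]
  set p₀ : ℂ × ℂ := (I * (1 / 512 : ℂ), I * (1 / 512 : ℂ)) with hp₀
  have hp₀n : ‖p₀‖ = 1 / 512 := by
    rw [hp₀, Prod.norm_def]; simp
  have hp₀Q : p₀ ∈ Qreg := by
    refine ⟨by rw [hp₀n]; norm_num, ?_, ?_⟩
    · simp [hp₀]; norm_num
    · simp [hp₀]; norm_num
  have h1 : p₀ ∈ Qreg ∩ {w : ℂ × ℂ | 0 < w.1.im} := ⟨hp₀Q, by simp [hp₀]⟩
  have h2 : p₀ ∈ Qreg ∩ {w : ℂ × ℂ | 0 < w.2.im} := ⟨hp₀Q, by simp [hp₀]⟩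
  exact IsPreconnected.union p₀ h1 h2 (convex_Qreg.inter (convex_halfSpace_gt isLinearMap_im_fst _)).isPreconnected
    (convex_Qreg.inter (convex_halfSpace_gt isLinearMap_im_snd _)).isPreconnected

/-- IDENTITY THEOREM: the circle average agrees with `f` on all of `Q ∩ U`. -/
theorem ext_eqOn {f : ℂ × ℂ → ℂ} {M : ℝ} (hf : DifferentiableOn ℂ f Udom) (hM : ∀ w ∈ Udom, ‖f w‖ ≤ M) :
    EqOn (ext f) f (Qreg ∩ {w : ℂ × ℂ | 0 < w.1.im ∨ 0 < w.2.im}) := by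
  set W := Qreg ∩ {w : ℂ × ℂ | 0 < w.1.im ∨ 0 < w.2.im} with hW
  have hWU : W ⊆ Udom := fun w hw => ⟨lt_trans hw.1.1 (by norm_num), hw.2⟩
  have hGan : AnalyticOnNhd ℂ (ext f) W :=
    (Literature.Analysis.Complex.SCV.analyticOnNhd_of_differentiableOn (differentiableOn_ext hf hM) isOpen_Qreg).mono
      inter_subset_left
  have hfan : AnalyticOnNhd ℂ f W :=
    (Literature.Analysis.Complex.SCV.analyticOnNhd_of_differentiableOn hf isOpen_Udom).mono hWU
  -- the base point `q⋆ = (0.3 i, 0)` whose closed disc lies in `{Im w₁ > 0}`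
  set qs : ℂ × ℂ := (I * (3 / 10 : ℂ), 0) with hqs
  have hqsn : ‖qs‖ = 3 / 10 := by rw [hqs, Prod.norm_def]; simp; norm_num
  have hqsW : qs ∈ W := by
    refine ⟨⟨by rw [hqsn]; norm_num, ?_, ?_⟩, ?_⟩
    · simp [hqs]; norm_num
    · simp [hqs]
    · simp [hqs]
  have hev : ext f =ᶠ[𝓝 qs] f := by
    filter_upwards [Metric.ball_mem_nhds qs (show (0 : ℝ) < 1 / 64 by norm_num)] with q hq
    refine ext_eq_self hf fun l hl => ?_
    rw [Metric.mem_ball, dist_eq_norm] at hq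
    have hqn : ‖q‖ < 1 / 2 := by
      have := norm_le_norm_add_norm_sub' q qs   -- ‖q‖ ≤ ‖qs‖ + ‖q - qs‖
      linarith
    refine ⟨norm_discMap_lt_one hqn hl, Or.inl ?_⟩
    -- `Im(q₁ + λ) ≥ Im qs₁ − ‖q − qs‖ − ‖λ‖ > 0`
    have him : |(q - qs).1.im| ≤ ‖q - qs‖ := (Complex.abs_im_le_norm _).trans (norm_fst_le _)
    have hl' : |l.im| ≤ ‖l‖ := Complex.abs_im_le_norm l
    rw [abs_le] at him hl'
    have hqs1 : qs.1.im = 3 / 10 := by simp [hqs]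
    have hsub : (q - qs).1.im = q.1.im - qs.1.im := by simp
    show 0 < (q.1 + l).im
    rw [Complex.add_im]
    linarith
  exact hGan.eqOn_of_preconnected_of_eventuallyEq hfan isPreconnected_Qreg_inter hqsW hev

/-! ## The rung -/

/-- **RUNG R-S3a (by name): `FlatDoubleEdgeModel`**, with `δ = 1/256`. -/
theorem flatDoubleEdgeModel_holds : FlatDoubleEdgeModel := by
  refine ⟨1 / 256, by norm_num, fun f M hf hM => ?_⟩
  have hM' : ∀ w ∈ Udom, ‖f w‖ ≤ M := fun w hw => hM w hw.1 hw.2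
  refine ⟨ext f, (differentiableOn_ext hf hM').mono ball_subset_Qreg, fun w hw => norm_ext_le hM' (ball_subset_Qreg hw),
    fun w hw him => ?_⟩
  exact ext_eqOn hf hM' ⟨ball_subset_Qreg hw, him⟩

end Summit.QuantumFields.YangMills.Theorems.F4SubCurvatureDoorFlatDoubleEdgeModelRegistered

end
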